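import Summits.HodgeConjecture.HodgeConjecture.Theorems.VHCAbelianSchemesRoadSecantAnchor
import Summits.HodgeConjecture.HodgeConjecture.Theorems.VHCAbelianSchemesRoadDesignNecessary
import Literature.AlgebraicGeometry.HodgeTheory.TwistedReflexiveClassOfSchemeIso
import HarnessLib

/-!
# Road b02 (`VHCAbelianSchemesRoad`, D-0059) — ISO-RESPECT OF THE DOORS: the sheaf door unconditionally, the twisted door `AdmTw`
# modulo ONE notion-level statement about the σ-notion (the displayed `h𝒪`/`hresp`/`htr` hypotheses reduced)

research route conditional on HC_CM; not a corollary; Q11.4-sentence-2 already refuted in dim ≥ 3.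

FACT-FREE bookkeeping (seat b02 gen 87; ring2 LEAD gen 151 l.4940 OPTIONAL ITEM «`twistedReflexiveClass_respectsIso`», helpers
`--supports` stmt-HodgeConjecture-19787). Several kernel theorems of the road DISPLAY the hypothesis that a door `𝒪` RESPECTS ISOMORPHISMS of
`ℂ`-schemes — `h𝒪 : ∀ n ⦃Y Y'⦄ (e : Y' ≅ Y) I κ, 𝒪 n Y I κ → 𝒪 n Y' I (fun q ↦ e^*(κ q))` (PART Z-c `design_on_self_of_designModLefschetzAt_of_respectsIso`;
`hresp` of `carrierAnchors_transport_of_respectsIso` / `secantAnchor_transport_of_respectsIso`; the `htr` input of PART AA-c). The Literature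
file `HodgeTheory/TwistedReflexiveClassOfSchemeIso.lean` (same seat) proves that the twisted door `twistedReflexiveClass C Adm` respects
isomorphisms as soon as the admissibility NOTION `Adm` is invariant under pull-back along isomorphisms, and that Buchweitz–Flenner's notion
`bfSingleAdmissible` is (via the tree's `IsISemiregular.of_schemeIso`). This file draws the road-side consequences:

* §1 the UNTWISTED SHEAF DOOR `bfSheafClass C` (venture; the door of the road's untwisted crux 19779 and of the BF corner) respects isomorphisms
  UNCONDITIONALLY (`bfSheafClass_respectsIso`: push the `I`-semiregular vector bundle forward along `e⁻¹`, `ch_p((e⁻¹)_* E₀) = e^* ch_p(E₀)`), whence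
  PART Z-c's design-on-self statement for it with NO displayed hypothesis (`design_on_self_of_designModLefschetzAt_bfSheafClass`).
* §2 the crux's TWISTED DOOR `twistedReflexiveClass C AdmTw`, `AdmTw := gluableSigmaAdmissible ∨ bfSingleAdmissible`: its `h𝒪`/`hresp` follows from
  ONE displayed NOTION-LEVEL hypothesis `hσ` — «the venture's σ-notion `gluableSigmaAdmissible` (`{1..n} ⊆ I`; `Ext^{<0}_{D(Mod 𝒪_X)}(E,E) = 0`;
  `(σ_q(E•))_{q+1 ∈ I}` jointly injective) is invariant under term-wise pull-back of bounded complexes of vector bundles along isomorphisms of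
  `ℂ`-schemes» (`twistedDoor_respectsIso_of_sigmaPullback`); the BF half of `AdmTw` needs nothing. `hσ` is EXACTLY the σ-stack debt recorded by
  gen 86 (ring2 INBOX l.4952: `extRank` and `HomComplex.IsISemiregularC` have no base-change-along-`e_*` lemma; typer debt REQUESTS l.2005) — now
  ONE typed sentence instead of a door-level hypothesis; the corollaries `secantAnchor_transport_of_sigmaPullback` and
  `design_on_self_of_designModLefschetzAt_tw_of_sigmaPullback` are L3's / PART Z-c's displayed-hypothesis theorems with `h𝒪` so reduced.

Nothing here says any cell, carrier statement, residual, K-SR♭∃, VHC, `HC_AV` or HC holds; `HC_CM` occurs nowhere; no statement of any item is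
touched. References: [cite: BuchweitzFlenner2003, Def. 4.1 and §5 (I-semiregular)] [cite: Perry2026Semiregularity, Thm. 1.1 (hypotheses)]
[cite: Fulton1998, §15.1 (ii)] [cite: Bloch1972Semiregularity, Remark (7.5)].
-/

noncomputable section

open CategoryTheory CategoryTheory.Limits AlgebraicGeometry Topology
open AlgebraicGeometry.Scheme.Modules

namespace Summit.HodgeConjecture.HodgeConjecture.Ring2.SemiregularRepresentatives

-- the cell's namespace repeats the summit name (`Summit.HodgeConjecture.HodgeConjecture…`), as in every `Ring2*` file
set_option linter.dupNamespace false

open Literature.AlgebraicGeometry Literature.AlgebraicGeometry.Motives Literature.AlgebraicGeometry.Modules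
open Literature.AlgebraicGeometry.HodgeTheory
open Literature.AlgebraicGeometry.KTheory
open Literature.AlgebraicTopology.SingularHomology
open Literature.Barriers.HodgeConjecture (divisorClassesSpan)
open Summit.Ventures.HSemireg (ObjClass bfSheafClass gluableSigmaAdmissible)

/-! ## §1 The untwisted sheaf door respects isomorphisms, unconditionally -/

section Sheaf

variable (C : ChernCharacterBetti)

/-- **The Buchweitz–Flenner SHEAF door `bfSheafClass C` RESPECTS ISOMORPHISMS of `ℂ`-schemes** (no hypothesis): for `e : Y' ≅ Y` and an
`I`-semiregular vector bundle `E₀` on `Y` with `κ_p = ch_p(E₀)`, the push-forward `(e⁻¹)_* E₀` on `Y'` is finite locally free, `I`-semiregular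
(`IsISemiregular.of_schemeIso` — «`ℰ_0` is `I`-semiregular» is a property of `(X₀, ℰ_0)` up to isomorphism) and `ch_p((e⁻¹)_* E₀) = e^* ch_p(E₀)`
(`ChernCharacterBetti.ch_pushforward_of_iso`). [cite: BuchweitzFlenner2003, §5 (I-semiregular)] [cite: Fulton1998, §15.1 (ii)] -/
theorem bfSheafClass_respectsIso :
    ∀ (n : ℕ) ⦃Y Y' : SchemeOver ℂ⦄ (e : Y' ≅ Y) (I : Finset ℕ) (κ : (q : ℕ) → complexBetti Y (2 * q)),
      bfSheafClass C n Y I κ → bfSheafClass C n Y' I (fun q ↦ complexBetti.map e.hom (2 * q) (κ q)) := by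
  intro n Y Y' e I κ h
  obtain ⟨E₀, hE₀, hsr, hch⟩ := h
  refine ⟨(pushforward e.inv.left).obj E₀, hE₀.pushforward_of_iso (leftIso' e.symm),
    IsISemiregular.of_schemeIso e.symm hE₀ hsr, fun p hp ↦ ?_⟩
  change complexBetti.map e.hom (2 * p) (κ p) = _
  rw [hch p hp]
  exact (ChernCharacterBetti.ch_pushforward_of_iso C e.symm hE₀ p).symm

/-- **PART Z-c's design-on-self for the SHEAF door, with NO displayed hypothesis**: `DesignModLefschetzAt (bfSheafClass C) n p` gives, at
every `(X, w)` as there (`X` isomorphic to an abelian `n`-fold, `w` rational algebraic off `Dᵖ ⊗ ℂ`), a Buchweitz–Flenner sheaf datum ON `X`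
with `κ_p = a·w + z`, `a ≠ 0`, `z` an algebraic Lefschetz class, every `κ_q` of type `(q,q)` (`design_on_self_of_designModLefschetzAt_of_respectsIso`
fed with `bfSheafClass_respectsIso`). [cite: Bloch1972Semiregularity, Remark (7.5)] [cite: BuchweitzFlenner2003, §5 (I-semiregular)] -/
theorem design_on_self_of_designModLefschetzAt_bfSheafClass {n p : ℕ} (h : DesignModLefschetzAt (bfSheafClass C) n p)
    (X : SchemeOver ℂ) (hX : ∃ A : AbelianVariety ℂ, A.dim = n ∧ Nonempty (A.X ≅ X))
    (w : complexBetti X (2 * p)) (hwQ : IsRationalClass w) (hwalg : w ∈ algebraicClasses X p) (hwD : w ∉ divisorClassesSpan X n p) :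
    ∃ (I : Finset ℕ) (κ : (q : ℕ) → complexBetti X (2 * q)) (a : ℂ) (z : complexBetti X (2 * p)),
      p ∈ I ∧ bfSheafClass C n X I κ ∧ a ≠ 0 ∧ z ∈ algebraicClasses X p ∧ z ∈ divisorClassesSpan X n p ∧ κ p = a • w + z ∧
      ∀ q ∈ I, IsOfHodgeType n X (2 * q) q q (κ q) :=
  design_on_self_of_designModLefschetzAt_of_respectsIso (bfSheafClass_respectsIso C) h X hX w hwQ hwalg hwD

end Sheaf

/-! ## §2 The twisted door `AdmTw`: iso-respect from ONE notion-level statement about the σ-notion -/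

section Twisted

variable (C : ChernCharacterBetti)

/-- **`h𝒪`/`hresp` FOR THE CRUX'S TWISTED DOOR from the σ-notion's pull-back invariance.** If the venture's `gluableSigmaAdmissible`
is invariant under term-wise pull-back of bounded complexes of vector bundles along isomorphisms of `ℂ`-schemes (hypothesis `hσ`, displayed —
the σ-stack's base change along `e_*` for `extRank` and `HomComplex.IsISemiregularC`, not in the tree today), then the door
`twistedReflexiveClass C AdmTw`, `AdmTw := gluableSigmaAdmissible ∨ bfSingleAdmissible`, RESPECTS ISOMORPHISMS — the Buchweitz–Flenner half
unconditionally (Literature `twistedReflexiveClass_respectsIso_or_bfSingle`). [cite: Perry2026Semiregularity, Thm. 1.1 (hypotheses)]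
[cite: BuchweitzFlenner2003, §5 (I-semiregular)] -/
theorem twistedDoor_respectsIso_of_sigmaPullback
    (hσ : ∀ (n : ℕ) ⦃Y Y' : SchemeOver ℂ⦄ (e : Y' ≅ Y) (I : Finset ℕ) (E : CochainComplex Y.left.Modules ℤ),
      IsBoundedVBComplex E → gluableSigmaAdmissible n Y I E →
        gluableSigmaAdmissible n Y' I (((Scheme.Modules.pullback e.hom.left).mapHomologicalComplex _).obj E)) :
    ∀ (n : ℕ) ⦃Y Y' : SchemeOver ℂ⦄ (e : Y' ≅ Y) (I : Finset ℕ) (κ : (q : ℕ) → complexBetti Y (2 * q)),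
      Literature.AlgebraicGeometry.HodgeTheory.twistedReflexiveClass C
          (fun n X₀ I E => Summit.Ventures.HSemireg.gluableSigmaAdmissible n X₀ I E ∨
            Literature.AlgebraicGeometry.HodgeTheory.bfSingleAdmissible n X₀ I E) n Y I κ →
        Literature.AlgebraicGeometry.HodgeTheory.twistedReflexiveClass C
          (fun n X₀ I E => Summit.Ventures.HSemireg.gluableSigmaAdmissible n X₀ I E ∨
            Literature.AlgebraicGeometry.HodgeTheory.bfSingleAdmissible n X₀ I E) n Y' I
          (fun q ↦ complexBetti.map e.hom (2 * q) (κ q)) :=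
  twistedReflexiveClass_respectsIso_or_bfSingle C hσ

/-- **L3's transport of the secant-anchor data with `hresp` reduced to `hσ`**: modulo the σ-notion's pull-back invariance alone, `θ ∈` secant
anchors of `X` and `w` served there give `e.inv^*θ ∈` secant anchors of `X'` and `e.inv^*w` served there, for `e : X ≅ X'` (the `htr` input of
PART AA-c `not_forall_not_hasServedFibre_63_of_anchor`). [folklore] [cite: HatcherAT2002, Prop. 3.10] -/
theorem secantAnchor_transport_of_sigmaPullback
    (hσ : ∀ (n : ℕ) ⦃Y Y' : SchemeOver ℂ⦄ (e : Y' ≅ Y) (I : Finset ℕ) (E : CochainComplex Y.left.Modules ℤ),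
      IsBoundedVBComplex E → gluableSigmaAdmissible n Y I E →
        gluableSigmaAdmissible n Y' I (((Scheme.Modules.pullback e.hom.left).mapHomologicalComplex _).obj E)) :
    ∀ ⦃X X' : SchemeOver ℂ⦄ (e : X ≅ X') (θ : complexBetti X 2) (w : complexBetti X (2 * 3)),
      θ ∈ secantAnchorSixfold C X → w ∈ secantServedClasses C X θ →
        complexBetti.map e.inv 2 θ ∈ secantAnchorSixfold C X' ∧
          complexBetti.map e.inv (2 * 3) w ∈ secantServedClasses C X' (complexBetti.map e.inv 2 θ) :=
  secantAnchor_transport_of_respectsIso (twistedDoor_respectsIso_of_sigmaPullback C hσ)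

/-- **PART Z-c's design-on-self for the TWISTED door with `h𝒪` reduced to `hσ`**: modulo the σ-notion's pull-back invariance alone, the
per-variety lower bound `DesignModLefschetzAt (tw C AdmTw) n p` of every cell (PART Z-c/Z-d: implied by the cell, in particular by the `(6,3)` rung)
yields its twisted datum ON `X` itself. [cite: Bloch1972Semiregularity, Remark (7.5)] [cite: Perry2026Semiregularity, Thm. 1.1 (hypotheses)] -/
theorem design_on_self_of_designModLefschetzAt_tw_of_sigmaPullback
    (hσ : ∀ (n : ℕ) ⦃Y Y' : SchemeOver ℂ⦄ (e : Y' ≅ Y) (I : Finset ℕ) (E : CochainComplex Y.left.Modules ℤ),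
      IsBoundedVBComplex E → gluableSigmaAdmissible n Y I E →
        gluableSigmaAdmissible n Y' I (((Scheme.Modules.pullback e.hom.left).mapHomologicalComplex _).obj E))
    {n p : ℕ} (h : DesignModLefschetzAt (Literature.AlgebraicGeometry.HodgeTheory.twistedReflexiveClass C
      (fun n X₀ I E => Summit.Ventures.HSemireg.gluableSigmaAdmissible n X₀ I E ∨
        Literature.AlgebraicGeometry.HodgeTheory.bfSingleAdmissible n X₀ I E)) n p)
    (X : SchemeOver ℂ) (hX : ∃ A : AbelianVariety ℂ, A.dim = n ∧ Nonempty (A.X ≅ X))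
    (w : complexBetti X (2 * p)) (hwQ : IsRationalClass w) (hwalg : w ∈ algebraicClasses X p) (hwD : w ∉ divisorClassesSpan X n p) :
    ∃ (I : Finset ℕ) (κ : (q : ℕ) → complexBetti X (2 * q)) (a : ℂ) (z : complexBetti X (2 * p)),
      p ∈ I ∧ Literature.AlgebraicGeometry.HodgeTheory.twistedReflexiveClass C
        (fun n X₀ I E => Summit.Ventures.HSemireg.gluableSigmaAdmissible n X₀ I E ∨
          Literature.AlgebraicGeometry.HodgeTheory.bfSingleAdmissible n X₀ I E) n X I κ ∧
      a ≠ 0 ∧ z ∈ algebraicClasses X p ∧ z ∈ divisorClassesSpan X n p ∧ κ p = a • w + z ∧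
      ∀ q ∈ I, IsOfHodgeType n X (2 * q) q q (κ q) :=
  design_on_self_of_designModLefschetzAt_of_respectsIso (twistedDoor_respectsIso_of_sigmaPullback C hσ) h X hX w hwQ hwalg hwD

end Twisted

end Summit.HodgeConjecture.HodgeConjecture.Ring2.SemiregularRepresentatives

end
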